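/-
Copyright: the b2b-balaban T⁴-continuum CRUX team, row NE7b OWNER lineage `t4-ne7b-p1` (gen 134). Project licence.
-/
import Summits.QuantumFields.BalabanUV.T4Continuum.Spine.NE7b.SupCellGraphDistance
import Summits.QuantumFields.BalabanUV.T4Continuum.Spine.NE7b.SupBlockingLargeSets

/-!
# THE LARGE-SET SEPARATION OF (360) HOLDS WHENEVER NON-ADJACENT BLOCKS ARE FAR APART IN THE CELL GRAPH: let `B : V → W` map cells to blocks with a
# block adjacency `R'` (symmetric, `≤ Δ'` neighbours) such that cells of DISTINCT NON-ADJACENT blocks are at graph distance `≥ 2r + 1` in the cell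
# graph generated by `R`.  Then every `R`-connected cell set `Y` meeting `k` blocks satisfies
#   `⌊(r+1)∕(Δ'+1)⌋·(k − (Δ'+1)) + 1 ≤ #Y`
# — the hypothesis `hsep` of (360) with `m = Δ' + 1`, `ℓ = ⌊(r+1)∕(Δ'+1)⌋`: among the `k` blocks a greedy choice gives `≥ k∕(Δ'+1)` pairwise non-adjacent
# ones; the graph balls of radius `r` about one cell of `Y` in each are pairwise disjoint; and a connected `Y` leaving a ball crosses every sphere,
# so each ball holds `≥ r + 1` cells of `Y` (discrete intermediate values of the graph distance along `R`-paths).  For cubes of side `L` in `ℤ^d` ∕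
# a torus with nearest-neighbour cells: `Δ' + 1 = 3^d`, `2r + 1 = L + 1` (row NE7b, node U5c; (340)'s potential `dist_{fromRel R}` + Mathlib's
# `Reachable.dist_triangle_left`, `card_le_card_of_surjOn`, `card_biUnion`, greedy independent sets by `Finset.strongInduction` BY NAME; [folklore])

Cell `pub-balaban`, sub-cell `t4`, spine estimate NE7b (`T4WeightBudget.RelWeightBound`; the cell's OWN estimate — NOT PRINTED in
[Bałaban 1983–89], NOT PROVED).  Crux-route work under `Spine/NE7b/` by the row OWNER (`t4-ne7b-p1` gen 134, file (362)) under FREEZE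
(0)'s crux-prover clause, on `g134/records/SCOPING-d6-iteration.md` (L2)∕DECISION (4) (making (360)'s separation a consequence of a distance
hypothesis on the block map); NOTHING of Bałaban's is named as a Lean object, valued or asserted; no `T4Continuum/Support` leaf typed; no `def`, no
notation; zero `sorry`.  Imports (BY NAME): the OWNER's (340) `…SupCellGraphDistance` (`dist_le_dist_add_one_of_rel`, `reachable_of_rel`), (360)
`…SupBlockingLargeSets` (the consumer; brings `IsRConnected`); Mathlib's `SimpleGraph.fromRel`, `SimpleGraph.dist`, `Adj.diff_dist_adj`,
`Reachable.dist_triangle_left`, `SimpleGraph.dist_comm`, `Finset.card_le_card_of_surjOn`, `Finset.card_biUnion`, `Finset.card_image_of_injOn`,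
`Finset.card_sdiff_add_card_inter`, `Finset.strongInduction`.

WHAT IS PROVED ([folklore]; `d = (SimpleGraph.fromRel R).dist`):
* §1 graph balls inside connected sets: `dist_le_dist_add_one_of_rel'`, `reachable_of_mem_rconnected`, **`exists_mem_dist_eq`** (discrete intermediate
  values: `Y` connected, `y, z ∈ Y`, `j ≤ d y z` ⟹ some `w ∈ Y` has `d y w = j`), **`succ_le_card_ball`** (`r ≤ d y z` ⟹ `r + 1 ≤ #{w ∈ Y : d y w ≤ r}`),
  **`disjoint_balls`** (`2r+1 ≤ d y y'` ⟹ the two balls in `Y` are disjoint), **`card_mul_le_card_of_far`** (`S ⊆ Y` pairwise `2r+1`-far, `#S ≥ 2` ⟹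
  `#S·(r+1) ≤ #Y`);
* §2 **`exists_independent`** (greedy: a finite set of a symmetric graph with `≤ Δ'` neighbours contains a pairwise non-adjacent subset `S` with
  `#A ≤ #S·(Δ'+1)`);
* §3 THE END **`largeSet_separation`** (`⌊(r+1)∕(Δ'+1)⌋·(#B(Y) − (Δ'+1)) + 1 ≤ #Y` for every `R`-connected `Y`, under the distance hypothesis on
  non-adjacent blocks) — (360)'s `hsep`; §4 toy.

HONEST (what this is NOT).  Graph combinatorics; the distance hypothesis for a concrete blocking (cubes on the torus `Site d s` with (132)'s block distance)
is not instantiated here; no analysis; scalar skeleton ((A3), NC-NE7b-α UNRULED); nothing of Bałaban's asserted.  BY-NAME EFFECT ON THE WALL: NONE.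
NE7b NOT PRINTED ∕ NOT PROVED; spine PROVED 0∕9; rung (B)+1 — the programme's measures remain FINITE-torus statements; NOT the mass gap, NOT Clay.
HONEST DEPENDENCY: continuum YM on T⁴ ⇐ BetaPertH ∧ nine spine estimates (0∕9 proved); BetaPertH ⇐ (D1) ∧ (D4) ∧ CAP+tail; G-an2-4 gates asym,
D1 and NE2∕3∕4.
-/

set_option autoImplicit false

namespace Summit.QuantumFields.BalabanUV.T4Continuum.NE7b.SupLargeSetSeparation

open Finset
open Literature.Probability.LatticeModels
open SupCellGraphDistance (dist_le_dist_add_one_of_rel reachable_of_rel)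

variable {V W : Type*} [DecidableEq V] [DecidableEq W] {R : V → V → Prop} {R' : W → W → Prop}

/-! ## §1. Graph balls inside connected cell sets -/

omit [DecidableEq V] in
/-- The potential property in the other direction: `R x y ⟹ d x ≤ d y + 1` (the generated simple graph is symmetric). [folklore] -/
theorem dist_le_dist_add_one_of_rel' (p₀ : V) {x y : V} (hxy : R x y) :
    (SimpleGraph.fromRel R).dist p₀ x ≤ (SimpleGraph.fromRel R).dist p₀ y + 1 := by
  by_cases hne : x = y
  · subst hne; omega
  · have hadj : (SimpleGraph.fromRel R).Adj y x := (SimpleGraph.fromRel_adj R y x).2 ⟨Ne.symm hne, Or.inr hxy⟩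
    rcases hadj.diff_dist_adj (u := p₀) with h | h | h <;> omega

omit [DecidableEq V] in
/-- Cells of an `R`-connected set are mutually reachable in the generated simple graph. [folklore] -/
theorem reachable_of_mem_rconnected {Y : Finset V} (hY : IsRConnected R Y) {y z : V} (hy : y ∈ Y) (hz : z ∈ Y) :
    (SimpleGraph.fromRel R).Reachable y z := by
  have key : ∀ u, Relation.ReflTransGen (fun a b => R a b ∧ a ∈ Y ∧ b ∈ Y) y u → (SimpleGraph.fromRel R).Reachable y u := by
    intro u hu
    induction hu with
    | refl => exact SimpleGraph.Reachable.refl _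
    | tail _ hst ih => exact reachable_of_rel y hst.1 ih
  exact key z (hY.2 y hy z hz)

omit [DecidableEq V] in
/-- **DISCRETE INTERMEDIATE VALUES**: along an `R`-connected set the graph distance from a cell of the set takes every value up to the distance of
any other cell of the set. [folklore] -/
theorem exists_mem_dist_eq {Y : Finset V} (hY : IsRConnected R Y) {y z : V} (hy : y ∈ Y) (hz : z ∈ Y) {j : ℕ}
    (hj : j ≤ (SimpleGraph.fromRel R).dist y z) : ∃ w ∈ Y, (SimpleGraph.fromRel R).dist y w = j := by
  have key : ∀ u, Relation.ReflTransGen (fun a b => R a b ∧ a ∈ Y ∧ b ∈ Y) y u →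
      ∀ j ≤ (SimpleGraph.fromRel R).dist y u, ∃ w ∈ Y, (SimpleGraph.fromRel R).dist y w = j := by
    intro u hu
    induction hu with
    | refl =>
        intro j hj
        rw [SimpleGraph.dist_self] at hj
        exact ⟨y, hy, by rw [Nat.le_zero.1 hj, SimpleGraph.dist_self]⟩
    | @tail b c _ hst ih =>
        intro j hj
        obtain ⟨hr, -, hc⟩ := hst
        have hstep : (SimpleGraph.fromRel R).dist y c ≤ (SimpleGraph.fromRel R).dist y b + 1 := dist_le_dist_add_one_of_rel y hr
        by_cases hjb : j ≤ (SimpleGraph.fromRel R).dist y b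
        · exact ih j hjb
        · exact ⟨c, hc, by omega⟩
  exact key z (hY.2 y hy z hz) j hj

omit [DecidableEq V] in
/-- **A CONNECTED SET LEAVING A BALL FILLS ITS RADII**: `Y` connected, `y, z ∈ Y`, `r ≤ d y z` ⟹ `r + 1 ≤ #{w ∈ Y : d y w ≤ r}`. [folklore] -/
theorem succ_le_card_ball {Y : Finset V} (hY : IsRConnected R Y) {y z : V} (hy : y ∈ Y) (hz : z ∈ Y) {r : ℕ}
    (hr : r ≤ (SimpleGraph.fromRel R).dist y z) :
    r + 1 ≤ (Y.filter fun w => (SimpleGraph.fromRel R).dist y w ≤ r).card := by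
  have hsurj : Set.SurjOn (fun w => (SimpleGraph.fromRel R).dist y w) ↑(Y.filter fun w => (SimpleGraph.fromRel R).dist y w ≤ r)
      ↑(range (r + 1)) := by
    intro j hj
    have hj' : j ≤ r := Nat.lt_succ_iff.1 (mem_range.1 (mem_coe.1 hj))
    obtain ⟨w, hw, hdw⟩ := exists_mem_dist_eq hY hy hz (hj'.trans hr)
    exact ⟨w, mem_coe.2 (mem_filter.2 ⟨hw, by rw [hdw]; exact hj'⟩), hdw⟩
  have h := card_le_card_of_surjOn _ hsurj
  simpa using h

omit [DecidableEq V] in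
/-- **FAR CENTRES HAVE DISJOINT BALLS**: `y, y' ∈ Y` (connected), `2r + 1 ≤ d y y'` ⟹ the radius-`r` balls about them inside `Y` are disjoint (triangle
inequality for reachable cells). [folklore] -/
theorem disjoint_balls {Y : Finset V} (hY : IsRConnected R Y) {y y' : V} (hy : y ∈ Y) {r : ℕ}
    (hfar : 2 * r + 1 ≤ (SimpleGraph.fromRel R).dist y y') :
    Disjoint (Y.filter fun w => (SimpleGraph.fromRel R).dist y w ≤ r) (Y.filter fun w => (SimpleGraph.fromRel R).dist y' w ≤ r) := by
  rw [Finset.disjoint_left]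
  intro w hw hw'
  obtain ⟨hwY, hdw⟩ := mem_filter.1 hw
  obtain ⟨-, hdw'⟩ := mem_filter.1 hw'
  have htri := (reachable_of_mem_rconnected hY hy hwY).dist_triangle_left y'
  have hc : (SimpleGraph.fromRel R).dist w y' = (SimpleGraph.fromRel R).dist y' w := SimpleGraph.dist_comm
  omega

/-- **PAIRWISE FAR CENTRES IN A CONNECTED SET COST `r + 1` CELLS EACH**: `S ⊆ Y` with `#S ≥ 2` and `2r+1 ≤ d s s'` for distinct `s, s' ∈ S` ⟹
`#S·(r+1) ≤ #Y`. [folklore] -/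
theorem card_mul_le_card_of_far {Y S : Finset V} (hY : IsRConnected R Y) (hS : S ⊆ Y) (h2 : 2 ≤ S.card) {r : ℕ}
    (hfar : ∀ s ∈ S, ∀ s' ∈ S, s ≠ s' → 2 * r + 1 ≤ (SimpleGraph.fromRel R).dist s s') :
    S.card * (r + 1) ≤ Y.card := by
  set ball : V → Finset V := fun s => Y.filter fun w => (SimpleGraph.fromRel R).dist s w ≤ r with hball
  have hdisj : (S : Set V).PairwiseDisjoint ball := fun s hs s' hs' hne => disjoint_balls hY (hS hs) (hfar s hs s' hs' hne)
  have hsub : S.biUnion ball ⊆ Y := biUnion_subset.2 fun s _ => filter_subset _ _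
  have hcard : ∀ s ∈ S, r + 1 ≤ (ball s).card := by
    intro s hs
    obtain ⟨s', hs', hne⟩ := (one_lt_card_iff_nontrivial.1 (show 1 < S.card by omega)).exists_ne s
    have h := hfar s hs s' hs' (Ne.symm hne)
    have hr : r ≤ (SimpleGraph.fromRel R).dist s s' := by omega
    exact succ_le_card_ball hY (hS hs) (hS hs') hr
  calc S.card * (r + 1) = ∑ _s ∈ S, (r + 1) := by rw [sum_const, smul_eq_mul]
    _ ≤ ∑ s ∈ S, (ball s).card := sum_le_sum hcard
    _ = (S.biUnion ball).card := (card_biUnion hdisj).symm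
    _ ≤ Y.card := card_le_card hsub

/-! ## §2. Greedy independent sets in a bounded-degree graph -/

omit [DecidableEq V] in
/-- **GREEDY**: `R'` symmetric with neighbour lists of size `≤ Δ'` ⟹ every finite `A` contains a pairwise non-adjacent `S ⊆ A` with `#A ≤ #S·(Δ'+1)`.
[folklore] -/
theorem exists_independent (hR' : ∀ a b, R' a b → R' b a) {nbr' : W → Finset W} {Δ' : ℕ} (hΔ' : ∀ a, (nbr' a).card ≤ Δ')
    (hnbr' : ∀ a b, R' a b → b ∈ nbr' a) (A : Finset W) :
    ∃ S ⊆ A, (∀ a ∈ S, ∀ b ∈ S, a ≠ b → ¬ R' a b) ∧ A.card ≤ S.card * (Δ' + 1) := by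
  induction A using Finset.strongInduction with
  | H A ih =>
    rcases A.eq_empty_or_nonempty with rfl | ⟨a, ha⟩
    · exact ⟨∅, subset_rfl, by simp, by simp⟩
    · set A' := A \ insert a (nbr' a) with hA'
      have hss : A' ⊂ A := by
        refine Finset.ssubset_iff_subset_ne.2 ⟨sdiff_subset, fun h => ?_⟩
        have haA' : a ∈ A' := h ▸ ha
        exact (mem_sdiff.1 haA').2 (mem_insert_self _ _)
      obtain ⟨S, hSA', hind, hcard⟩ := ih A' hss
      have haS : a ∉ S := fun h => (mem_sdiff.1 (hSA' h)).2 (mem_insert_self _ _)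
      refine ⟨insert a S, insert_subset ha (hSA'.trans sdiff_subset), ?_, ?_⟩
      · intro x hx y hy hxy
        rcases mem_insert.1 hx with rfl | hxS
        · rcases mem_insert.1 hy with rfl | hyS
          · exact absurd rfl hxy
          · exact fun hr => (mem_sdiff.1 (hSA' hyS)).2 (mem_insert_of_mem (hnbr' _ _ hr))
        · rcases mem_insert.1 hy with rfl | hyS
          · exact fun hr => (mem_sdiff.1 (hSA' hxS)).2 (mem_insert_of_mem (hnbr' _ _ (hR' _ _ hr)))
          · exact hind x hxS y hyS hxy
      · rw [card_insert_of_notMem haS]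
        have h1 : A.card ≤ A'.card + (insert a (nbr' a)).card := by
          have h := card_sdiff_add_card_inter A (insert a (nbr' a))
          rw [← hA'] at h
          have h2 : (A ∩ insert a (nbr' a)).card ≤ (insert a (nbr' a)).card := card_le_card inter_subset_right
          omega
        have h3 : (insert a (nbr' a)).card ≤ Δ' + 1 := (card_insert_le _ _).trans (Nat.add_le_add_right (hΔ' a) 1)
        calc A.card ≤ A'.card + (insert a (nbr' a)).card := h1
          _ ≤ S.card * (Δ' + 1) + (Δ' + 1) := add_le_add hcard h3
          _ = (S.card + 1) * (Δ' + 1) := by ring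

/-! ## §3. THE END: the large-set separation from far non-adjacent blocks -/

/-- **THE LARGE-SET SEPARATION FROM FAR NON-ADJACENT BLOCKS.**  `Y` an `R`-connected cell set; a block map `B : V → W` with a symmetric block adjacency
`R'` of `≤ Δ'` neighbours; cells of `Y` in distinct non-adjacent blocks at graph distance `≥ 2r + 1` ⟹
`⌊(r+1)∕(Δ'+1)⌋·(#B(Y) − (Δ'+1)) + 1 ≤ #Y` — the hypothesis `hsep` of (360) with `m = Δ'+1`, `ℓ = ⌊(r+1)∕(Δ'+1)⌋`. [folklore] -/
theorem largeSet_separation {Y : Finset V} (hY : IsRConnected R Y) (B : V → W) (hR' : ∀ a b, R' a b → R' b a) {nbr' : W → Finset W} {Δ' : ℕ}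
    (hΔ' : ∀ a, (nbr' a).card ≤ Δ') (hnbr' : ∀ a b, R' a b → b ∈ nbr' a) {r : ℕ}
    (hfar : ∀ x ∈ Y, ∀ y ∈ Y, B x ≠ B y → ¬ R' (B x) (B y) → 2 * r + 1 ≤ (SimpleGraph.fromRel R).dist x y) :
    (r + 1) / (Δ' + 1) * ((Y.image B).card - (Δ' + 1)) + 1 ≤ Y.card := by
  classical
  obtain ⟨S', hS'sub, hind, hk⟩ := exists_independent hR' hΔ' hnbr' (Y.image B)
  by_cases h2 : 2 ≤ S'.card
  · -- one centre per chosen block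
    haveI : Nonempty V := ⟨hY.1.choose⟩
    have hc : ∀ p' ∈ S', ∃ y ∈ Y, B y = p' := fun p' hp' => by
      obtain ⟨y, hy, hyB⟩ := mem_image.1 (hS'sub hp')
      exact ⟨y, hy, hyB⟩
    choose! c hcY hcB using hc
    have hcinj : Set.InjOn c S' := fun p hp q hq hpq => by
      have h := congrArg B hpq
      rwa [hcB p (mem_coe.1 hp), hcB q (mem_coe.1 hq)] at h
    set S : Finset V := S'.image c with hSdef
    have hScard : S.card = S'.card := card_image_of_injOn hcinj
    have hSY : S ⊆ Y := image_subset_iff.2 fun p hp => hcY p hp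
    have hfarS : ∀ s ∈ S, ∀ s' ∈ S, s ≠ s' → 2 * r + 1 ≤ (SimpleGraph.fromRel R).dist s s' := by
      intro s hs s' hs' hne
      obtain ⟨p, hp, rfl⟩ := mem_image.1 hs
      obtain ⟨q, hq, rfl⟩ := mem_image.1 hs'
      have hpq : p ≠ q := fun h => hne (by rw [h])
      refine hfar _ (hcY p hp) _ (hcY q hq) ?_ ?_
      · rw [hcB p hp, hcB q hq]; exact hpq
      · rw [hcB p hp, hcB q hq]; exact hind p hp q hq hpq
    have hmain := card_mul_le_card_of_far hY hSY (by rw [hScard]; exact h2) hfarS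
    rw [hScard] at hmain
    -- arithmetic: `ℓ(k − m) + 1 ≤ (r+1)(s−1) + 1 ≤ (r+1)s ≤ #Y`
    set s := S'.card with hsdef
    set m := Δ' + 1 with hmdef
    set k := (Y.image B).card with hkdef
    have hkm : k - m ≤ m * (s - 1) := by
      calc k - m ≤ s * m - m := Nat.sub_le_sub_right hk m
        _ = m * (s - 1) := by rw [Nat.mul_sub_one, Nat.mul_comm s m]
    have hℓ : (r + 1) / m * m ≤ r + 1 := Nat.div_mul_le_self (r + 1) m
    have hs1 : 1 ≤ s := by omega
    calc (r + 1) / m * (k - m) + 1 ≤ (r + 1) / m * (m * (s - 1)) + 1 := by gcongr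
      _ = ((r + 1) / m * m) * (s - 1) + 1 := by ring
      _ ≤ (r + 1) * (s - 1) + 1 := by gcongr
      _ ≤ (r + 1) * (s - 1) + (r + 1) := by omega
      _ = (r + 1) * (s - 1 + 1) := by ring
      _ = s * (r + 1) := by rw [Nat.sub_add_cancel hs1, Nat.mul_comm]
      _ ≤ Y.card := hmain
  · -- few independent blocks: the block support is a small set
    have hs : S'.card ≤ 1 := by omega
    have hk' : (Y.image B).card ≤ Δ' + 1 :=
      hk.trans ((Nat.mul_le_mul_right _ hs).trans (by rw [one_mul]))
    rw [Nat.sub_eq_zero_of_le hk', mul_zero, zero_add]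
    exact card_pos.2 hY.1

/-! ## §4. Toy -/

omit [DecidableEq V] in
/-- Toy (§2): with NO edges (`R' = ⊥`, empty neighbour lists) the greedy independent set is all of `A`: `#A ≤ #S·1`. -/
example (A : Finset W) : ∃ S ⊆ A, (∀ a ∈ S, ∀ b ∈ S, a ≠ b → ¬ (fun _ _ : W => False) a b) ∧ A.card ≤ S.card * (0 + 1) :=
  exists_independent (R' := fun _ _ => False) (fun _ _ h => h) (nbr' := fun _ => ∅) (fun _ => by simp) (fun _ _ h => h.elim) A

end Summit.QuantumFields.BalabanUV.T4Continuum.NE7b.SupLargeSetSeparation
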